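import Summits.Ventures.Crystal3D.Theorems.StickyWulffConstantCoaxialWallLawTailResidueDefsU
import Summits.Ventures.Crystal3D.Theorems.StickyWulffConstantCoaxialWallLawTailResidueModuleCaptureShallow
import Summits.Ventures.Crystal3D.Theorems.StickyWulffConstantCoaxialWallLawReadingDirectionsContacts
import Summits.Ventures.Crystal3D.Theorems.StickyWulffConstantCoaxialWallLawLensCapacity
import Summits.Ventures.Crystal3D.Theorems.StickyWulffConstantCoaxialWallLawOnSiteBridge
import HarnessLib

/-!
# A CAPPING BALL OVER A MODULE TRIANGLE SITS AT A FIRST-GENERATION APEX POSITION; capping windows over on-site windows are mono-module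
# (crux `CoaxialWallLaw`, stmt-Ventures-19481, line `WallLedgerF`; census-free brick for the U-A1 reduction `jammedOneSmall_of_census`)

HONEST FRAMING. Venture `Summits/Ventures/Crystal3D` (cell `crystal3d-full`), helper `--supports` the crux `CoaxialWallLaw` of
`route-Ventures-StickyWulffConstant` (REGISTERED line `WallLedgerF`, skeleton 'CoaxialWallLawCertificates' v4; v5 texts `…TailResidueDefsU`).  Rung credit
only; F-C1 not moved; census-free.  The comparison `…JammedComparison` needs the jammed ball `x` to be NON-CAPPING (not touching three pairwise touching
balls).  This file shows that the capping case belongs to the MONO-MODULE regime, so it is excluded by the hypothesis `¬ MonoModuleAt` of `JammedOneSmall`: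
* `eq_or_eq_faceTwin_of_apex` — over a unit triangle `{0, a, b}` (`‖a‖ = ‖b‖ = 1`, `⟪a, b⟫ = ½`) a unit vector at `60°` from `a` and `b` is `p` or
  `⅔(a + b) − p` for any one such `p` (coefficients in the tetrahedral frame of `…LensCapacity`); `eq_or_eq_of_two_apices` — hence one of any two distinct ones;
* `apexFine_cap_table` (kernel `decide` over the `84` adjacent menu pairs): both fine apex vectors `apexFine a b up` are unit, at `60°` from the two menu
  vectors, and distinct; `norm_fineVec_apexFine`, `inner_fineVec_apexFine_left/right`, `fineVec_apexFine_ne`;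
* **`exists_apexFine_of_capping`** — a point `x` touching three pairwise touching module points `modSite sᵢ` is `modSite s₁ + fineVec (apexFine a b up)`
  for the menu pair `(a, b) = (s₂ − s₁, s₃ − s₁)`; **`mem_exactPos_of_capping`** — if moreover `x` is off the module and within `3` of the payer and `s₁`
  is a window site, then `x ∈ exactPos` (an `apexBall` position);
* **`monoModuleAt_of_capping`** — at a payer `z` of `X` whose window minus one ball `x` (within `3` of `z`) is on-site for 𝒰_cx with pattern `P`, if the
  transported `x` caps three pairwise touching balls of `P` and is off the module, then `MonoModuleAt L X z` for every frame `L` (every ball of the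
  transported window within `3` is at an exact position, and the automaton inspects nothing farther).
WHAT THIS IS NOT: not the comparison, not the census; F-C1 not moved.
-/

noncomputable section

namespace Summit.Ventures.Crystal3D.Theorems

namespace TailResidue

open Summit.Ventures.Crystal3D Finset
open scoped InnerProductSpace

/-! ### The two apices over a unit triangle -/

/-- **Over a unit triangle `{0, a, b}` there are two unit apices, `p` and `⅔(a + b) − p`.** -/
theorem eq_or_eq_faceTwin_of_apex {a b p u : EuclideanSpace ℝ (Fin 3)} (ha : ‖a‖ = 1) (hb : ‖b‖ = 1) (hab : ⟪a, b⟫_ℝ = 1 / 2)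
    (hp : ‖p‖ = 1) (hap : ⟪a, p⟫_ℝ = 1 / 2) (hbp : ⟪b, p⟫_ℝ = 1 / 2)
    (hu : ‖u‖ = 1) (hua : ⟪u, a⟫_ℝ = 1 / 2) (hub : ⟪u, b⟫_ℝ = 1 / 2) : u = p ∨ u = (2 / 3 : ℝ) • (a + b) - p := by
  obtain ⟨l, m, n, rfl⟩ := LensCapacity.exists_coeffs ha hb hp hab hap hbp u
  obtain ⟨h1, h2, -, h4⟩ := LensCapacity.inner_combo ha hb hp hab hap hbp l m n
  rw [h1] at hua
  rw [h2] at hub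
  rw [hu] at h4
  have hm : m = l := by linarith
  have hn : n = 1 - 3 * l := by linarith
  have key : l * (3 * l - 2) = 0 := by
    rw [hm, hn] at h4
    linear_combination (-(1 : ℝ) / 2) * h4
  rcases mul_eq_zero.1 key with h0 | h0
  · left
    have hm0 : m = 0 := by rw [hm, h0]
    have hn1 : n = 1 := by rw [hn, h0]; norm_num
    rw [h0, hm0, hn1]
    simp
  · right
    have hl : l = 2 / 3 := by linarith
    have hm' : m = 2 / 3 := by rw [hm, hl]
    have hn' : n = -1 := by rw [hn, hl]; norm_num
    rw [hl, hm', hn', smul_add]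
    module

/-- **A unit apex over a unit triangle is one of any two distinct unit apices.** -/
theorem eq_or_eq_of_two_apices {a b p p' u : EuclideanSpace ℝ (Fin 3)} (ha : ‖a‖ = 1) (hb : ‖b‖ = 1) (hab : ⟪a, b⟫_ℝ = 1 / 2)
    (hp : ‖p‖ = 1) (hap : ⟪a, p⟫_ℝ = 1 / 2) (hbp : ⟪b, p⟫_ℝ = 1 / 2)
    (hp' : ‖p'‖ = 1) (hap' : ⟪a, p'⟫_ℝ = 1 / 2) (hbp' : ⟪b, p'⟫_ℝ = 1 / 2) (hne : p' ≠ p)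
    (hu : ‖u‖ = 1) (hua : ⟪u, a⟫_ℝ = 1 / 2) (hub : ⟪u, b⟫_ℝ = 1 / 2) : u = p ∨ u = p' := by
  have hp'a : ⟪p', a⟫_ℝ = 1 / 2 := by rw [real_inner_comm]; exact hap'
  have hp'b : ⟪p', b⟫_ℝ = 1 / 2 := by rw [real_inner_comm]; exact hbp'
  have h' : p' = (2 / 3 : ℝ) • (a + b) - p := (eq_or_eq_faceTwin_of_apex ha hb hab hp hap hbp hp' hp'a hp'b).resolve_left hne
  rcases eq_or_eq_faceTwin_of_apex ha hb hab hp hap hbp hu hua hub with h | h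
  · exact Or.inl h
  · exact Or.inr (h.trans h'.symm)

/-! ### The fine apex vectors of an adjacent menu pair -/

set_option maxRecDepth 65536 in
/-- Table (kernel `decide`, `84` adjacent menu pairs): both fine apex vectors are unit and at `60°` from the two menu vectors, and they are distinct. -/
theorem apexFine_cap_table : ∀ ab ∈ menuPairs,
    (dotI (apexFine ab.1 ab.2 true) (apexFine ab.1 ab.2 true) = 162 ∧ dotI (apexFine ab.1 ab.2 true) (siteFine ab.1) = 81 ∧
      dotI (apexFine ab.1 ab.2 true) (siteFine ab.2) = 81) ∧
    (dotI (apexFine ab.1 ab.2 false) (apexFine ab.1 ab.2 false) = 162 ∧ dotI (apexFine ab.1 ab.2 false) (siteFine ab.1) = 81 ∧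
      dotI (apexFine ab.1 ab.2 false) (siteFine ab.2) = 81) ∧
    dotI (apexFine ab.1 ab.2 true) (apexFine ab.1 ab.2 false) ≠ 162 := by
  decide

/-- The fine integer facts of one side. -/
theorem apexFine_cap_facts {a b : ℤ × ℤ × ℤ} (hab : (a, b) ∈ menuPairs) (up : Bool) :
    dotI (apexFine a b up) (apexFine a b up) = 162 ∧ dotI (apexFine a b up) (siteFine a) = 81 ∧ dotI (apexFine a b up) (siteFine b) = 81 := by
  obtain ⟨ht, hf, -⟩ := apexFine_cap_table (a, b) hab
  cases up
  · exact hf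
  · exact ht

/-- The fine apex vectors are unit vectors. -/
theorem norm_fineVec_apexFine {a b : ℤ × ℤ × ℤ} (hab : (a, b) ∈ menuPairs) (up : Bool) : ‖fineVec (apexFine a b up)‖ = 1 := by
  have h := norm_fineVec_sq (apexFine a b up)
  rw [(apexFine_cap_facts hab up).1] at h
  have h1 : ‖fineVec (apexFine a b up)‖ ^ 2 = 1 := by rw [h]; norm_num
  exact (pow_eq_one_iff_of_nonneg (norm_nonneg _) two_ne_zero).1 h1

/-- The fine apex vector is at `60°` from the first menu vector. -/
theorem inner_fineVec_apexFine_left {a b : ℤ × ℤ × ℤ} (hab : (a, b) ∈ menuPairs) (up : Bool) :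
    ⟪modSite a, fineVec (apexFine a b up)⟫_ℝ = 1 / 2 := by
  rw [modSite_eq_fineVec, real_inner_comm, inner_fineVec, (apexFine_cap_facts hab up).2.1]; norm_num

/-- The fine apex vector is at `60°` from the second menu vector. -/
theorem inner_fineVec_apexFine_right {a b : ℤ × ℤ × ℤ} (hab : (a, b) ∈ menuPairs) (up : Bool) :
    ⟪modSite b, fineVec (apexFine a b up)⟫_ℝ = 1 / 2 := by
  rw [modSite_eq_fineVec, real_inner_comm, inner_fineVec, (apexFine_cap_facts hab up).2.2]; norm_num

/-- The two fine apex vectors are distinct. -/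
theorem fineVec_apexFine_ne {a b : ℤ × ℤ × ℤ} (hab : (a, b) ∈ menuPairs) : fineVec (apexFine a b false) ≠ fineVec (apexFine a b true) := by
  intro h
  obtain ⟨⟨ht, -, -⟩, -, hne⟩ := apexFine_cap_table (a, b) hab
  apply hne
  have key : ((dotI (apexFine a b true) (apexFine a b false) : ℤ) : ℝ) / 162 = 1 := by
    rw [← inner_fineVec, h, inner_fineVec, ht]; norm_num
  have key' : ((dotI (apexFine a b true) (apexFine a b false) : ℤ) : ℝ) = ((162 : ℤ) : ℝ) := by
    push_cast; linarith
  exact Int.cast_injective key'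

/-! ### Capping balls over module triangles -/

/-- Componentwise difference of sites. -/
theorem modSite_sub' (s t : ℤ × ℤ × ℤ) : modSite s - modSite t = modSite (s.1 - t.1, s.2.1 - t.2.1, s.2.2 - t.2.2) :=
  modSite_sub t s

/-- Inner product with a contact direction: `dist x t = 1`, `dist x (t + a) = 1`, `‖a‖ = 1` ⇒ `⟪x − t, a⟫ = ½`. -/
theorem inner_eq_half_of_contacts {x t a : EuclideanSpace ℝ (Fin 3)} (ha : ‖a‖ = 1) (h0 : dist x t = 1) (h1 : dist x (t + a) = 1) :
    ⟪x - t, a⟫_ℝ = 1 / 2 := by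
  have hu : ‖x - t‖ = 1 := by rw [← dist_eq_norm, h0]
  have hua : ‖x - t - a‖ = 1 := by rw [sub_sub, ← dist_eq_norm, h1]
  have hsq : ‖x - t - a‖ ^ 2 = ‖x - t‖ ^ 2 - 2 * ⟪x - t, a⟫_ℝ + ‖a‖ ^ 2 := norm_sub_sq_real _ _
  rw [hua, hu, ha] at hsq
  linarith

/-- **A point touching three pairwise touching module points sits at a fine apex position over them.** -/
theorem exists_apexFine_of_capping {x : EuclideanSpace ℝ (Fin 3)} {s₁ s₂ s₃ : ℤ × ℤ × ℤ}
    (d12 : dist (modSite s₁) (modSite s₂) = 1) (d13 : dist (modSite s₁) (modSite s₃) = 1) (d23 : dist (modSite s₂) (modSite s₃) = 1)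
    (e1 : dist x (modSite s₁) = 1) (e2 : dist x (modSite s₂) = 1) (e3 : dist x (modSite s₃) = 1) :
    ∃ up : Bool, ((s₂.1 - s₁.1, s₂.2.1 - s₁.2.1, s₂.2.2 - s₁.2.2), (s₃.1 - s₁.1, s₃.2.1 - s₁.2.1, s₃.2.2 - s₁.2.2)) ∈ menuPairs ∧
      x = modSite s₁ + fineVec (apexFine (s₂.1 - s₁.1, s₂.2.1 - s₁.2.1, s₂.2.2 - s₁.2.2) (s₃.1 - s₁.1, s₃.2.1 - s₁.2.1, s₃.2.2 - s₁.2.2) up) := by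
  set da : ℤ × ℤ × ℤ := (s₂.1 - s₁.1, s₂.2.1 - s₁.2.1, s₂.2.2 - s₁.2.2) with hda
  set db : ℤ × ℤ × ℤ := (s₃.1 - s₁.1, s₃.2.1 - s₁.2.1, s₃.2.2 - s₁.2.2) with hdb
  have ha_eq : modSite s₂ = modSite s₁ + modSite da := by rw [hda, ← modSite_sub' s₂ s₁]; abel
  have hb_eq : modSite s₃ = modSite s₁ + modSite db := by rw [hdb, ← modSite_sub' s₃ s₁]; abel
  -- the two menu vectors
  have hna : ‖modSite da‖ = 1 := by
    rw [hda, ← modSite_sub' s₂ s₁, ← dist_eq_norm, dist_comm]; exact d12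
  have hnb : ‖modSite db‖ = 1 := by
    rw [hdb, ← modSite_sub' s₃ s₁, ← dist_eq_norm, dist_comm]; exact d13
  have hdsa : dsq12 (0, 0, 0) da = 12 := by
    have h := norm_modSite_sq da
    rw [hna, one_pow] at h
    have : (dsq12 (0, 0, 0) da : ℝ) = 12 := by linarith
    exact_mod_cast this
  have hdsb : dsq12 (0, 0, 0) db = 12 := by
    have h := norm_modSite_sq db
    rw [hnb, one_pow] at h
    have : (dsq12 (0, 0, 0) db : ℝ) = 12 := by linarith
    exact_mod_cast this
  have hdab : dsq12 da db = 12 := by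
    have h := dist_modSite_sq da db
    have hd : dist (modSite da) (modSite db) = 1 := by
      have : dist (modSite s₂) (modSite s₃) = dist (modSite da) (modSite db) := by
        rw [ha_eq, hb_eq, dist_eq_norm, dist_eq_norm]; congr 1; abel
      rw [← this]; exact d23
    rw [hd, one_pow] at h
    have : (dsq12 da db : ℝ) = 12 := by linarith
    exact_mod_cast this
  have hab : (da, db) ∈ menuPairs := by
    unfold menuPairs
    exact mem_filter.2 ⟨mem_product.2 ⟨mem_menuOffsets_of_dsq12 hdsa, mem_menuOffsets_of_dsq12 hdsb⟩, hdab⟩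
  have hinab : ⟪modSite da, modSite db⟫_ℝ = 1 / 2 := by
    have hd : dist (modSite s₂) (modSite s₃) = 1 := d23
    rw [ha_eq, hb_eq, dist_eq_norm, add_sub_add_left_eq_sub] at hd
    have hsq : ‖modSite da - modSite db‖ ^ 2 = ‖modSite da‖ ^ 2 - 2 * ⟪modSite da, modSite db⟫_ℝ + ‖modSite db‖ ^ 2 :=
      norm_sub_sq_real _ _
    rw [hd, hna, hnb] at hsq
    linarith
  -- the contact vector
  have hu : ‖x - modSite s₁‖ = 1 := by rw [← dist_eq_norm, e1]
  have hua : ⟪x - modSite s₁, modSite da⟫_ℝ = 1 / 2 := inner_eq_half_of_contacts hna e1 (by rw [← ha_eq]; exact e2)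
  have hub : ⟪x - modSite s₁, modSite db⟫_ℝ = 1 / 2 := inner_eq_half_of_contacts hnb e1 (by rw [← hb_eq]; exact e3)
  rcases eq_or_eq_of_two_apices hna hnb hinab (norm_fineVec_apexFine hab true) (inner_fineVec_apexFine_left hab true)
      (inner_fineVec_apexFine_right hab true) (norm_fineVec_apexFine hab false) (inner_fineVec_apexFine_left hab false)
      (inner_fineVec_apexFine_right hab false) (fineVec_apexFine_ne hab) hu hua hub with h | h
  · exact ⟨true, hab, by rw [← h]; abel⟩
  · exact ⟨false, hab, by rw [← h]; abel⟩

/-- Fine vectors add componentwise. -/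
theorem fineVec_addI (t u : ℤ × ℤ × ℤ) : fineVec (addI t u) = fineVec t + fineVec u := by
  have h := fineVec_lin t u 1
  push_cast at h
  rw [one_smul] at h
  rw [← h]
  congr 1
  ext <;> simp [addI]

/-- Window sites lie in `siteBox4`. -/
theorem mem_siteBox4_of_dsq12 {d : ℤ × ℤ × ℤ} (h : dsq12 (0, 0, 0) d ≤ 108) : d ∈ siteBox4 := by
  obtain ⟨i, n, k⟩ := d
  have h' := h
  simp only [dsq12, sub_zero] at h'
  rw [siteBox4, Finset.mem_filter, Finset.mem_product, Finset.mem_product, Finset.mem_Icc, Finset.mem_Icc, Finset.mem_Icc]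
  refine ⟨⟨⟨?_, ?_⟩, ⟨?_, ?_⟩, ⟨?_, ?_⟩⟩, by simp only [dsq12, sub_zero]; omega⟩ <;>
    nlinarith [sq_nonneg (2 * i + n), sq_nonneg n, sq_nonneg k, sq_nonneg (i + n), sq_nonneg i]

set_option maxRecDepth 65536 in
-- the window Finsets (`siteBox4`, `apexBall`) are large closed terms; unification around them needs a deeper recursion budget
/-- **A CAPPING BALL OFF THE MODULE, WITHIN `3` OF THE PAYER, OVER A WINDOW TRIANGLE IS AT AN EXACT (APEX) POSITION.** -/
theorem mem_exactPos_of_capping {x : EuclideanSpace ℝ (Fin 3)} {s₁ s₂ s₃ : ℤ × ℤ × ℤ}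
    (hxoff : x ∉ coaxialModule 1 (Real.sqrt (2 / 3))) (hx3 : dist (0 : EuclideanSpace ℝ (Fin 3)) x ≤ 3)
    (hs₁ : dsq12 (0, 0, 0) s₁ ≤ 108)
    (d12 : dist (modSite s₁) (modSite s₂) = 1) (d13 : dist (modSite s₁) (modSite s₃) = 1) (d23 : dist (modSite s₂) (modSite s₃) = 1)
    (e1 : dist x (modSite s₁) = 1) (e2 : dist x (modSite s₂) = 1) (e3 : dist x (modSite s₃) = 1) : x ∈ exactPos := by
  obtain ⟨up, hab, hx⟩ := exists_apexFine_of_capping d12 d13 d23 e1 e2 e3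
  set da : ℤ × ℤ × ℤ := (s₂.1 - s₁.1, s₂.2.1 - s₁.2.1, s₂.2.2 - s₁.2.2) with hda
  set db : ℤ × ℤ × ℤ := (s₃.1 - s₁.1, s₃.2.1 - s₁.2.1, s₃.2.2 - s₁.2.2) with hdb
  set F : ℤ × ℤ × ℤ := addI (siteFine s₁) (apexFine da db up) with hF
  have hxF : x = fineVec F := by rw [hF, fineVec_addI, ← modSite_eq_fineVec, hx]
  -- off the menu (since off the module)
  have hoff' : modSite s₁ + apexVec (modSite da) (modSite db) up ∉ coaxialModule 1 (Real.sqrt (2 / 3)) := by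
    rw [apexVec_modSite hab, ← hx]; exact hxoff
  have hside : ((da, db), up) ∈ apexSides := by
    unfold apexSides
    exact mem_filter.2 ⟨mem_product.2 ⟨hab, mem_univ _⟩, not_mem_image_of_off_module hab hoff'⟩
  -- the norm bound in fine coordinates
  have hnorm : dotI F F ≤ 1458 := by
    have h := norm_fineVec_sq F
    rw [← hxF] at h
    have h3 : ‖x‖ ≤ 3 := by rwa [dist_comm, dist_eq_norm, sub_zero] at hx3
    have : (dotI F F : ℝ) ≤ 1458 := by nlinarith [norm_nonneg x]
    exact_mod_cast this
  refine Or.inr ⟨F, ?_, hxF.symm⟩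
  rw [mem_coe]
  unfold apexBall
  refine mem_filter.2 ⟨mem_image.2 ⟨(s₁, ((da, db), up)), mem_product.2 ⟨mem_siteBox4_of_dsq12 hs₁, hside⟩, rfl⟩, hnorm⟩


/-! ### Capping windows over on-site windows are mono-module -/

/-- A pattern ball of 𝒰_cx is a window site: `p = modSite s` with `dsq12 0 s ≤ 108`. -/
theorem exists_site_of_mem_universe {P : Finset (EuclideanSpace ℝ (Fin 3))} (hP : P ∈ coaxialModuleUniverse) {p : EuclideanSpace ℝ (Fin 3)}
    (hp : p ∈ P) : ∃ s : ℤ × ℤ × ℤ, dsq12 (0, 0, 0) s ≤ 108 ∧ p = modSite s := by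
  obtain ⟨hsub, -, -, -⟩ := hP
  obtain ⟨hmod, hball⟩ := hsub (mem_coe.2 hp)
  obtain ⟨s, rfl⟩ := mem_coaxialModule_iff.1 hmod
  refine ⟨s, dsq12_le_of_norm_le_three ?_, rfl⟩
  rwa [Metric.mem_closedBall, dist_zero_right] at hball

/-- Pattern balls of 𝒰_cx are at exact positions. -/
theorem mem_exactPos_of_mem_universe {P : Finset (EuclideanSpace ℝ (Fin 3))} (hP : P ∈ coaxialModuleUniverse) {p : EuclideanSpace ℝ (Fin 3)}
    (hp : p ∈ P) : p ∈ exactPos := by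
  obtain ⟨s, hs, rfl⟩ := exists_site_of_mem_universe hP hp
  exact Or.inl ⟨s, mem_coe.2 (mem_siteBall_of_dsq12 hs), rfl⟩

/-- **CAPPING WINDOWS OVER ON-SITE WINDOWS ARE MONO-MODULE.**  At a payer `z` of `X`, let the window of `X.erase x` be on-site for 𝒰_cx with pattern
`P` and placement `S`, `x ∈ X` within `3` of `z`, and let the transported ball `x̃ = S⁻¹x − S⁻¹z` be off the module and CAP three pairwise touching balls
of `P`.  Then `MonoModuleAt L X z` for every frame `L`: every ball of the transported window within `3` of the payer is at an exact position (sites, and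
the apex position of `x̃`), and an end move near the payer inspects only balls within `3`. -/
theorem monoModuleAt_of_capping {L : EuclideanSpace ℝ (Fin 3) ≃ₗᵢ[ℝ] EuclideanSpace ℝ (Fin 3)} {X P : Finset (EuclideanSpace ℝ (Fin 3))}
    {z x : EuclideanSpace ℝ (Fin 3)} {S : EuclideanSpace ℝ (Fin 3) ≃ₗᵢ[ℝ] EuclideanSpace ℝ (Fin 3)} (hP : P ∈ coaxialModuleUniverse)
    (hwin : (X.erase x).filter (fun y => dist z y ≤ 3) = P.image fun p => S p + z) (hx : x ∈ X) (hzx : dist z x ≤ 3)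
    (hxoff : S.symm x + -S.symm z ∉ coaxialModule 1 (Real.sqrt (2 / 3)))
    {t₁ t₂ t₃ : EuclideanSpace ℝ (Fin 3)} (ht₁ : t₁ ∈ P) (ht₂ : t₂ ∈ P) (ht₃ : t₃ ∈ P)
    (d12 : dist t₁ t₂ = 1) (d13 : dist t₁ t₃ = 1) (d23 : dist t₂ t₃ = 1)
    (e1 : dist (S.symm x + -S.symm z) t₁ = 1) (e2 : dist (S.symm x + -S.symm z) t₂ = 1) (e3 : dist (S.symm x + -S.symm z) t₃ = 1) :
    MonoModuleAt L X z := by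
  classical
  set τ : EuclideanSpace ℝ (Fin 3) → EuclideanSpace ℝ (Fin 3) := fun y => S.symm y + -S.symm z with hτ
  have hagree := onSite_window_agree hwin
  -- the capping ball is at an apex position
  obtain ⟨s₁, hs₁, rfl⟩ := exists_site_of_mem_universe hP ht₁
  obtain ⟨s₂, -, rfl⟩ := exists_site_of_mem_universe hP ht₂
  obtain ⟨s₃, -, rfl⟩ := exists_site_of_mem_universe hP ht₃
  have hx3 : dist (0 : EuclideanSpace ℝ (Fin 3)) (S.symm x + -S.symm z) ≤ 3 := by rw [dist_zero_motion]; exact hzx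
  have hxE : S.symm x + -S.symm z ∈ exactPos := mem_exactPos_of_capping hxoff hx3 hs₁ d12 d13 d23 e1 e2 e3
  -- every ball of the transported window within `3` is exact
  have hYE : ∀ y ∈ X.image τ, dist (0 : EuclideanSpace ℝ (Fin 3)) y ≤ 3 → y ∈ exactPos := by
    intro y hy hy3
    obtain ⟨y₀, hy₀, rfl⟩ := mem_image.1 hy
    by_cases hyx : y₀ = x
    · subst hyx; exact hxE
    · exact mem_exactPos_of_mem_universe hP ((hagree _ hy3).1 (mem_image_of_mem _ (mem_erase.2 ⟨hyx, hy₀⟩)))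
  refine ⟨S, fun b q G d hb hq hbY hadm _ hmove => ?_⟩
  -- `‖d‖ = 1`, so `q` is within `2` of the payer
  have hd1 : ‖d‖ = 1 := by
    obtain ⟨w, hw, hdw⟩ : ∃ w ∈ fccSlots, -d = G w := by
      rcases hadm with h | h
      · exact exists_slot_neg_of_adm h
      · exact exists_slot_neg_of_adm h
    rw [← norm_neg, hdw, LinearIsometryEquiv.norm_map, norm_eq_one_of_mem_fccSlots hw]
  have hbq : dist b q = 1 := dist_eq_one_of_isEndMove hd1 hmove
  have hq2 : dist (0 : EuclideanSpace ℝ (Fin 3)) q ≤ 2 := by linarith [dist_triangle (0 : EuclideanSpace ℝ (Fin 3)) b q]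
  have slot3 : ∀ {c : EuclideanSpace ℝ (Fin 3)} {w : EuclideanSpace ℝ (Fin 3)}, dist (0 : EuclideanSpace ℝ (Fin 3)) c ≤ 2 → w ∈ fccSlots →
      dist (0 : EuclideanSpace ℝ (Fin 3)) (c + G w) ≤ 3 := by
    intro c w hc hw
    have : dist c (c + G w) = 1 := by rw [dist_eq_norm, sub_add_cancel_left, norm_neg, LinearIsometryEquiv.norm_map, norm_eq_one_of_mem_fccSlots hw]
    linarith [dist_triangle (0 : EuclideanSpace ℝ (Fin 3)) c (c + G w)]
  have mir3 : ∀ {c m : EuclideanSpace ℝ (Fin 3)} {w : EuclideanSpace ℝ (Fin 3)}, dist (0 : EuclideanSpace ℝ (Fin 3)) c ≤ 2 → w ∈ fccSlots → ‖m‖ = 1 →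
      dist (0 : EuclideanSpace ℝ (Fin 3)) (c + (G w - (2 * ⟪G w, m⟫_ℝ) • m)) ≤ 3 := by
    intro c m w hc hw hm
    have : dist c (c + (G w - (2 * ⟪G w, m⟫_ℝ) • m)) = 1 := by
      rw [dist_eq_norm, sub_add_cancel_left, norm_neg]
      exact norm_reflectStep_slot G hm hw
    linarith [dist_triangle (0 : EuclideanSpace ℝ (Fin 3)) c (c + (G w - (2 * ⟪G w, m⟫_ℝ) • m))]
  have hb2 : dist (0 : EuclideanSpace ℝ (Fin 3)) b ≤ 2 := by linarith
  refine ⟨hYE q hq (by linarith), hYE b hbY (by linarith), fun y hy hins => ?_⟩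
  obtain ⟨w, hw, h⟩ := hins
  rcases h with rfl | rfl | ⟨m, hm, rfl | rfl⟩
  · exact hYE _ hy (slot3 hq2 hw)
  · exact hYE _ hy (slot3 hb2 hw)
  · exact hYE _ hy (mir3 hq2 hw hm.1)
  · exact hYE _ hy (mir3 hb2 hw hm.1)

end TailResidue

end Summit.Ventures.Crystal3D.Theorems

end
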